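import Summits.BirchSwinnertonDyer.BirchSwinnertonDyer.Theorems.ErratumRoadFiveValueContinuityFactsAgree
import Summits.BirchSwinnertonDyer.Rank1Residual.X11b.BDPRouteValueFromContinuity
import Summits.BirchSwinnertonDyer.Rank1Residual.X11b.BDPRouteOpenInputSplitRecord
import Summits.BirchSwinnertonDyer.Rank1Residual.X11b.RouteR1LogOmega
import HarnessLib

/-!
# Route `ErratumRoadFive` (K2 at `p ≥ 5`), CLASSICAL Heegner data: the BDP VALUE AT `𝟙` cashed in
# from PRINT on EVERY X11b pair — route p2's value shape `P2.BDPValueSomeFrameOnTree` from Castella,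
# J. Inst. Math. Jussieu 17 (2018) Thms. 2.10–2.11; H∃♭ and the open input `P2OpenInputOnTreeAt`
# from the VALUE-FREE shape (2.4)∃♭ alone; the class record and K2's two no-road residuals re-read

Cell `bsd-stepL` (run/shared/lean/pub/bsd-stepL/), seat `bsd-stepL-bdp` (prover g12, 2026-08-26),
`--supports stmt-BirchSwinnertonDyer-19282`. Fifth file of the (VN_p) series (g11: p433271
`ErratumRoadFiveValueByNormContinuity`, p434829 `…OpenInputIMCOfNormContinuity`, p435482
`…NormContinuityFromPrint`, p438561 `…ValueContinuityFactsAgree`), now on the CLASSICAL road.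

HONEST FRAMING: theorems only (no definition, no named fact, no `sorry`); CONDITIONAL on the cited
REVIEWED Literature named fact `Castella2018Exceptional.thm210_thm211_bdpDisplay_pNew` (cell bsd-eis,
k5-c4; BDP 2013's own display at a `p`-new weight-two form, `p ≥ 5`, ANY conductor, STRICT Heegner
hypothesis) and, where stated, on the OPEN conjecture-tagged shape `P2.IMCDivSomeFrameOnTree`
((2.4)∃♭: one inclusion of the anticyclotomic main conjecture for SOME BDP frame at classical Heegner
fields, `p ∥ N` — no announced derivation at these data). Nothing is booked; no label, tier or census
word moves (T7); X11b stays CONSTRUCTION-SHAPED; BSD is not advanced by a class.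

## Why (the record before this file)

Route p2 (cell `b2b-bsdres`, sub-cell `multr1-p2`, gens 23–29) reads `BSD(E,p)` on class X11b at
`p ≥ 5` from published facts + per-pair certificates + ONE typed open input, split (gen 25, ♭-V1RIG) as
(2.4)∃♭ `P2.IMCDivSomeFrameOnTree` (OPEN) ∧ value∃♭ `P2.BDPValueSomeFrameOnTree` — the latter a THEOREM
on SEMISTABLE pairs (`h32`, Cas18 Thms. 3.1–3.2) and a TYPED BINDER `hVal` of the class record
`P2.bsdp_of_onTree_split` on the 1 514 163 NON-semistable pairs (sourced to [cas-split] Thm. 2.11, not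
typed on 2026-08-21; consumer-in-waiting `P2.bdpValueSomeFrameOnTree_of_hsieh2014_of_continuousDisplay`
with the display as hypothesis `hC`). Since 2026-08-26 [cas-split] Thms. 2.10–2.11 ARE a reviewed
Literature fact (bsd-eis `thm210_thm211_bdpDisplay_pNew`; BDP→Castella rescaling kernel-checked in
`X2/NonsplitBDPValueDisplayPNew.lean`; bridge to this cell's currency: g11
`bdpValueContinuity_on_heegnerData_of_pNew`).

## What this file proves

* §1 `continuousDisplayOnTree_of_pNew` — the hypothesis `hC` of the gen-25 consumer, at EVERY X11b
  classical datum (`p ≥ 5`), from the fact: virtual periods, a norm-one `u`, the display's CONTINUITY AT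
  `𝟙` with limit `c = u·((1 − a_p p⁻¹)·log_{ω_E} P')²`, and `c ≠ 0` (`a_p = ±1`, `‖1 − a_p/p‖ = p`;
  `log_{ω_E} P' ≠ 0` because `P'` — the Heegner point read through `w₀` — is a `Gal(K/ℚ)`-conjugate of
  the non-torsion `P`). Plumbing: `p` split from the strict Heegner hypothesis and `p ∣ N`; `𝔭_{ι'}`
  compatible with `ι'` at the unique infinite place (`forall_mem_primeOfEmbeddingDatum_iff`).
* §1 `bdpValueSomeFrameOnTree_of_hsieh2014_of_pNew` — **value∃♭ on EVERY X11b pair at `p ≥ 5`** from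
  Hsieh 2014 Thm. 1 (frame) + the fact (value), i.e. the binder `hVal` DISCHARGED from print.
* §2 `imcDivIntFrameOnTree_of_imcDivSomeFrame_of_pNew` — **H∃♭ ⟸ (2.4)∃♭ + the fact on EVERY pair**
  (no `h32`, no `Semistable`, no Hsieh: the frame is (2.4)∃♭'s own, its constant term is the limit by
  ONE-SIDED ♭-V1RIG `intSeries_constantCoeff_eq_of_isBDPLFunctionInt_of_continuousValues`); hence
  `openInputOnTreeAt_of_imcDivSomeFrame_of_pNew` — route p2's composite open input
  `P2OpenInputOnTreeAt W p` ⟸ (2.4)∃♭ at the pair + published/cited facts (and so the lower half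
  `Typed.MissingLowerBoundAt W p` by `P2.missingLowerBoundAt_of_imcDivIntFrame`).
* §3 `bsdp_of_onTree_split_of_pNew` — **the class record with `hVal` GONE and `h32` GONE** (published +
  cited facts, the fact, (2.4)∃♭ on every pair, (REG), (TC), the exceptional conjecture on split-only
  `p ∣ ∏c`, the corner): the value half is no longer an input ANYWHERE on the classical road.
* §4 the two NO-ROAD residuals of K2 after the planner's D4 re-glue, RE-READ VALUE-FREE:
  `openInputNotRam_of_imcDivSomeFrame_of_pNew` (the body of item 19282 `OpenInputNotRam`, cw 112 239)
  and `ramNoErratumData_of_imcDivSomeFrame_of_pNew` (REST‴ verbatim = the D4 crux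
  `RamNoErratumDataAtFive`, cw 703 204) follow from (2.4)∃♭ RESTRICTED TO THEIR PAIRS + print: on
  these rows too the value formula at `𝟙` is print; what is open is (2.4)∃♭ there.

References: [Castella2018Exceptional] Thms. 2.10–2.11 (arXiv:1507.04260 pp. 13–14); [Castella2018]
Thms. 3.1–3.2 (arXiv:1704.06608 p. 9); [Castella2018Erratum] (2.4); [Hsieh2014] Thm. 1.
-/

set_option autoImplicit false

noncomputable section

open scoped Classical NumberField Topology
open Filter WeierstrassCurve NumberField IsDedekindDomain Field PowerSeries
open Literature.NumberTheory.EllipticCurves Literature.NumberTheory.EllipticCurves.GreenbergSelmer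
open Literature.NumberTheory.EllipticCurves.ModularForms
open Literature.NumberTheory.EllipticCurves.Rank1Residual
open Literature.NumberTheory.EllipticCurves.Rank1Residual.Typed
open Literature.NumberTheory.EllipticCurves.Wuthrich2014
open Literature.NumberTheory.EllipticCurves.Castella2018
open Literature.NumberTheory.EllipticCurves.Castella2018Exceptional
open Literature.NumberTheory.EllipticCurves.SteinWuthrich2013
open Literature.NumberTheory.EllipticCurves.Disegni2020
open Literature.NumberTheory.EllipticCurves.Skinner2016
open Literature.NumberTheory.EllipticCurves.BalakrishnanEtAl2019
open Literature.NumberTheory.QuadraticFields.Quadratic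
open Literature.NumberTheory.GaloisRepresentations Literature.NumberTheory.GaloisCohomology
open Literature.NumberTheory.Automorphic
open Summit.BirchSwinnertonDyer.Rank1Residual Summit.BirchSwinnertonDyer.Rank1Residual.X11b
open Summit.BirchSwinnertonDyer.Rank1Residual.X11b.AcSelmer
open Summit.BirchSwinnertonDyer.Rank1Residual.X11b.Halves

namespace Summit.BirchSwinnertonDyer.BirchSwinnertonDyer.Theorems

/-! ### §1 The continuity display at every classical X11b datum; value∃♭ on every pair -/

section Pair

variable {W : WeierstrassCurve ℚ} [W.IsElliptic] [W.IsGloballyMinimal] {p : ℕ} [Fact p.Prime]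

/-- **The display's continuity at `𝟙`, with its non-zero limit, at EVERY classical X11b datum
(`p ≥ 5`) — from the published fact.** This is VERBATIM the hypothesis `hC` of
`P2.bdpValueSomeFrameOnTree_of_hsieh2014_of_continuousDisplay` (`X11b/BDPRouteValueFromContinuity.lean`):
at a datum of route p2's shapes there are virtual periods `Ω_K ≠ 0`, `Ω_p ≠ 0`, a `u` with `‖u‖ = 1`,
the BDP value `c = u·((1 − a_p p⁻¹)·log_{ω_E} P')² ≠ 0`, and
`ι'⁻¹(bdpInterpolationValue p f 𝔭_{ι'} φ_k n_k Ω_K)·Ω_p^{4n_k} → c` along every interpolation sequence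
through `κ` with `r_k(γ) → 1`. Continuity and limit: the fact through bsd-eis's rescaling
(`bdpValueContinuity_on_heegnerData_of_pNew`); `p` split in `K` from the strict Heegner hypothesis and
`p ∣ N`; `𝔭_{ι'} ∋ p` compatible with `ι'` (`forall_mem_primeOfEmbeddingDatum_iff`, one infinite
place). Non-vanishing: `p ∤ a_p` at a multiplicative `p` (`‖1 − a_p p⁻¹‖ = p`), and `log_{ω_E} P' ≠ 0`
since `P'` has infinite order — `ι = w₀ ∘ τ` for some `τ ∈ Gal(K/ℚ)`, so `τ_* P' = P` by injectivity of
`E(K) → E(ℂ)`, and `P` has infinite order. CONDITIONAL on the cited fact; nothing booked.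
[cite: Castella2018Exceptional, Thms. 2.10–2.11 (arXiv:1507.04260 pp. 13–14)]
[cite: BertoliniDarmonPrasanna2013, Thm. 5.13 and Prop. 5.10]
[cite: SilvermanAEC2009, IV.6.4 and VII.6.3] -/
theorem continuousDisplayOnTree_of_pNew (hB : thm210_thm211_bdpDisplay_pNew) :
    ∀ (N : ℕ) [NeZero N] (K : Type) [Field K] [NumberField K]
      (Dt : ModularParametrizationData W N) (H : HeegnerDatum N (NumberField.discr K)) (ι : K →+* ℂ)
      (P : (W.baseChange K).toAffine.Point),
      ClassX11b W p → 5 ≤ p → Surj W p → W.conductorNorm ℤ = N → IsImaginaryQuadratic K →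
      Odd (NumberField.discr K) → ¬ (p : ℤ) ∣ NumberField.discr K → ¬ p ∣ Units.torsionOrder K →
      SatisfiesHeegnerHypothesis N K →
      (W.quadraticTwist (NumberField.discr K : ℚ)).entireLFunction 1 ≠ 0 →
      WeierstrassCurve.Affine.Point.map ι.toRatAlgHom P = heegnerPointComplex Dt H →
      ¬ (p : ℤ) ∣ Dt.c → ¬ IsOfFinAddOrder P →
      ∀ (κ : ZpExtension K p), κ.IsAnticyclotomic →
        ∀ (γ : Field.absoluteGaloisGroup K) [Fact (κ.IsTopGenerator γ)]
          (ι' : PadicAlgCl p ≃+* ℂ) (w₀ : InfinitePlace K) (P' : (W.baseChange K).toAffine.Point),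
          WeierstrassCurve.Affine.Point.map w₀.embedding.toRatAlgHom P' = heegnerPointComplex Dt H →
          ∀ (e : K →+* ℚ_[p]),
            (∀ k : 𝓞 K, k ∈ (primeOfEmbeddingDatum p ι' w₀.embedding).asIdeal ↔ ‖e (k : K)‖ < 1) →
            ∃ (ΩK : ℂ) (Ωp u : ℂ_[p]), ΩK ≠ 0 ∧ Ωp ≠ 0 ∧ ‖u‖ = 1 ∧
              u * (algebraMap ℚ_[p] ℂ_[p] (((1 : ℚ_[p]) - ((W.LFunction p : ℤ) : ℚ_[p]) *
                (p : ℚ_[p])⁻¹) * logOmega W p e P')) ^ 2 ≠ 0 ∧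
              ∀ (φ : ℕ → HeckeCharacter K) (n : ℕ → ℕ) (r : ℕ → FramedGaloisRep K (PadicAlgCl p) 1),
                (∀ k, 0 < n k) → (∀ k (v : HeightOneSpectrum (𝓞 K)), (φ k).IsUnramifiedAt v) →
                (∀ k, (φ k).HasInfinityType (fun _ ↦ (n k : ℤ)) (fun _ ↦ -(n k : ℤ))) →
                (∀ k, IsPAdicAvatarOf ι' (φ k) (r k)) → (∀ k, FactorsThroughZp κ (r k)) →
                Tendsto (fun k ↦ avatarValueAt (r k) γ) atTop (𝓝 1) →
                Tendsto (fun k ↦ ((ι'.symm (bdpInterpolationValue p Dt.f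
                  (primeOfEmbeddingDatum p ι' w₀.embedding) (φ k) (n k) ΩK) : PadicAlgCl p) : ℂ_[p]) *
                  Ωp ^ (4 * n k)) atTop
                  (𝓝 (u * (algebraMap ℚ_[p] ℂ_[p] (((1 : ℚ_[p]) - ((W.LFunction p : ℤ) : ℚ_[p]) *
                    (p : ℚ_[p])⁻¹) * logOmega W p e P')) ^ 2)) := by
  intro N _ K _ _ Dt H ιK P hX h5 _hs hN hK hodd _hpd _hμ hHN _hLt hP hc hPinf κ hκ γ hγ ι' w₀ P' hP'
    e he
  obtain ⟨-, -, hmult, -⟩ := hX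
  have hp : p.Prime := Fact.out
  have hpN : p ∣ N := hN ▸ dvd_conductorNorm_of_mult hmult
  -- `P'` has infinite order: it is a `Gal(K/ℚ)`-conjugate of `P`
  have hPinf' : ¬ IsOfFinAddOrder P' := by
    haveI : IsGalois ℚ K := by
      haveI : Algebra.IsQuadraticExtension ℚ K := ⟨hK.1⟩
      infer_instance
    obtain ⟨σ, hσ⟩ := ComplexEmbedding.exists_comp_symm_eq_of_comp_eq (k := ℚ) ιK w₀.embedding
      (by ext x; simp)
    set τ : K →+* K := ((σ.symm : K ≃ₐ[ℚ] K) : K →+* K) with hτdef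
    have hcomp : ιK.toRatAlgHom.comp τ.toRatAlgHom = w₀.embedding.toRatAlgHom := by
      apply AlgHom.ext
      intro x
      have := RingHom.congr_fun hσ x
      simpa [hτdef] using this
    have hmap : WeierstrassCurve.Affine.Point.map ιK.toRatAlgHom
        (WeierstrassCurve.Affine.Point.map τ.toRatAlgHom P') =
        WeierstrassCurve.Affine.Point.map ιK.toRatAlgHom P := by
      rw [WeierstrassCurve.Affine.Point.map_map, hcomp, hP', hP]
    have hPP : WeierstrassCurve.Affine.Point.map τ.toRatAlgHom P' = P :=
      WeierstrassCurve.Affine.Point.map_injective (f := ιK.toRatAlgHom) hmap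
    intro h
    apply hPinf
    rw [← hPP]
    exact (WeierstrassCurve.Affine.Point.map_injective (f := τ.toRatAlgHom)).isOfFinAddOrder_iff.mpr h
  -- the display's continuity at `𝟙` from the fact (bsd-eis rescaling, g11's bridge)
  obtain ⟨ΩK, Ωp, u, hΩK, hΩp, hu, hcont⟩ := bdpValueContinuity_on_heegnerData_of_pNew hB ι' W K
    (primeOfEmbeddingDatum p ι' w₀.embedding) κ γ Dt H w₀ e P' h5 hN hmult hK hodd (hHN p hp hpN)
    (natCast_mem_primeOfEmbeddingDatum p ι' w₀.embedding)
    (forall_mem_primeOfEmbeddingDatum_iff p ι' hK w₀) hHN hκ hγ.out hc hP' he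
  -- the limit is non-zero
  have ha : ¬ (p : ℤ) ∣ W.LFunction p := R1.not_dvd_lFunction_of_mult Dt.isNewformOf hmult
  have hX0 : algebraMap ℚ_[p] ℂ_[p] (((1 : ℚ_[p]) - ((W.LFunction p : ℤ) : ℚ_[p]) * (p : ℚ_[p])⁻¹) *
      logOmega W p e P') ≠ 0 := by
    rw [map_ne_zero_iff _ (algebraMap ℚ_[p] ℂ_[p]).injective]
    refine mul_ne_zero ?_ (R1.logOmega_ne_zero W p e hPinf')
    intro h0
    have h := R1.norm_one_sub_div_eq p ha
    rw [h0, norm_zero] at h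
    have hp0 : (0 : ℝ) < p := by exact_mod_cast hp.pos
    exact absurd h (ne_of_lt hp0)
  have hu0 : u ≠ 0 := fun h0 ↦ by rw [h0, norm_zero] at hu; exact zero_ne_one hu
  refine ⟨ΩK, Ωp, u, hΩK, hΩp, hu, mul_ne_zero hu0 (pow_ne_zero _ hX0),
    fun φ n r hn hunr hinf hr hrκ hlim ↦ ?_⟩
  rw [R1.logOmega_eq_padicLogOmega]
  exact hcont φ n r hn hunr hinf hr hrκ hlim

variable (W p) in
/-- **value∃♭ on EVERY X11b pair at `p ≥ 5` — the class record's binder `hVal` DISCHARGED from print.**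
`P2.BDPValueSomeFrameOnTree W p` (per classical datum SOME ♭-frame `(Ω_K ≠ 0, ‖Ω_p‖ = 1, Q)` with
Castella's interpolation and `Q(𝟙) = u·((1 − a_p p⁻¹)·log_{ω_E} P')²`, `‖u‖ = 1`) from Hsieh 2014
Thm. 1 (the frame, Castella-normalised: multr1-p2 gen 25) and Castella JIMJ 17 (2018) Thms. 2.10–2.11
(the value, `continuousDisplayOnTree_of_pNew`), through the gen-25 consumer
`P2.bdpValueSomeFrameOnTree_of_hsieh2014_of_continuousDisplay`. Before this file the shape was a theorem
on SEMISTABLE pairs only (`h32`). CONDITIONAL on the two cited facts; nothing booked.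
[cite: Hsieh2014, Thm. 1 (arXiv:1112.1580 pp. 3–4)]
[cite: Castella2018Exceptional, Thms. 2.10–2.11 (arXiv:1507.04260 pp. 13–14)]
[cite: Castella2018, Thms. 3.1–3.2 (arXiv:1704.06608 p. 9) (shapes)] -/
theorem bdpValueSomeFrameOnTree_of_hsieh2014_of_pNew
    (hH : hsieh2014_exists_anticyclotomicPAdicLFunction) (hB : thm210_thm211_bdpDisplay_pNew) :
    P2.BDPValueSomeFrameOnTree W p :=
  P2.bdpValueSomeFrameOnTree_of_hsieh2014_of_continuousDisplay hH (continuousDisplayOnTree_of_pNew hB)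

/-! ### §2 H∃♭ and route p2's open input from the VALUE-FREE shape (2.4)∃♭, on EVERY pair -/

/-- **H∃♭ ⟸ (2.4)∃♭ + print, on EVERY X11b pair at `p ≥ 5`** (no `h32`, no `Semistable`, no Hsieh).
At a datum take (2.4)∃♭'s frame `(Ω_K, Ω_p, Q)` (interpolation ∧ divisibility); the display of
`continuousDisplayOnTree_of_pNew` is continuous at `𝟙` with non-zero limit `c`, so by ONE-SIDED ♭-V1RIG
(`intSeries_constantCoeff_eq_of_isBDPLFunctionInt_of_continuousValues`: `p ≠ 2` from X11b, `K`
imaginary quadratic, `κ` anticyclotomic, `γ` a topological generator) `[T⁰]Q = c`, which is the value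
clause `R1.BDPValueAtOneIntAt` for the SAME `Q`. Supersedes, on non-semistable pairs, the gen-25 split
`P2.imcDivIntFrameOnTree_of_someFrames` (which needed value∃♭ as a second input) and, on semistable
pairs, `P2.imcDivIntFrameOnTree_of_imcDivSomeFrame_of_semistable` (which needed `h32`). CONDITIONAL on
the fact and on (2.4)∃♭ (OPEN). [cite: Castella2018Exceptional, Thms. 2.10–2.11 (arXiv:1507.04260 pp. 13–14)]
[cite: Castella2018, Thms. 3.1–3.2 (arXiv:1704.06608 p. 9)] [cite: Castella2018Erratum, (2.4) (p. 4)] -/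
theorem imcDivIntFrameOnTree_of_imcDivSomeFrame_of_pNew (hB : thm210_thm211_bdpDisplay_pNew)
    (hD : P2.IMCDivSomeFrameOnTree W p) : P2.IMCDivIntFrameOnTree W p := by
  intro N _ K _ _ Dt H ιK P hX h5 hs hN hK hodd hpd hμ hHN hLt hP hc hPinf κ hκ γ hγ ι' w₀ P' hP' e he
  obtain ⟨ΩK, Ωp, Q, hΩK, hΩp, hQ, hdiv⟩ :=
    hD N K Dt H ιK P hX h5 hs hN hK hodd hpd hμ hHN hLt hP hc hPinf κ hκ γ ι' w₀ P' hP' e he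
  obtain ⟨ΩK₀, Ωp₀, u, hΩK₀, hΩp₀, hu, hc0, hcont⟩ := continuousDisplayOnTree_of_pNew hB N K Dt H ιK P
    hX h5 hs hN hK hodd hpd hμ hHN hLt hP hc hPinf κ hκ γ ι' w₀ P' hP' e he
  have hΩp0 : Ωp ≠ 0 := fun h ↦ by rw [h, norm_zero] at hΩp; exact zero_ne_one hΩp
  have heq := intSeries_constantCoeff_eq_of_isBDPLFunctionInt_of_continuousValues hX.2.1 hK hκ hγ.out
    hΩK₀ hΩK hΩp₀ hΩp0 hcont hc0 hQ
  refine ⟨ΩK, Ωp, Q, hΩK, hΩp, hQ, ⟨u, hu, ?_⟩, hdiv⟩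
  rw [← heq]
  exact R1.intSeries_hasValueAt_zero p Q

/-- **Route p2's composite open input `P2OpenInputOnTreeAt W p` ⟸ (2.4)∃♭ AT THE PAIR + published and
cited facts** (`P2.openInputOnTreeAt_of_imcDivIntFrame` on the H∃♭ of
`imcDivIntFrameOnTree_of_imcDivSomeFrame_of_pNew`): modularity, GZK, Kolyvagin, the cited Poitou–Tate ∕
local Euler characteristic (one-sided control), the JIMJ18 fact (value), and (2.4)∃♭. CONDITIONAL.
[cite: Castella2018Exceptional, Thms. 2.10–2.11 (arXiv:1507.04260 pp. 13–14)]
[cite: Castella2018, Thms. 2.3, 3.1, 3.2, §5 (arXiv:1704.06608 pp. 5, 9, 12)]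
[cite: Castella2018Erratum, (2.4) (p. 4)] [cite: MilneADT2006, Ch. I, Thm. 4.10(b) and Thm. 2.8] -/
theorem openInputOnTreeAt_of_imcDivSomeFrame_of_pNew (hnf : exists_isNewformOf)
    (hGZK : rank_eq_analyticRank_of_analyticRank_le_one)
    (hKo : ∀ (N : ℕ) [NeZero N] (W : WeierstrassCurve ℚ) (K : Type) [Field K] [NumberField K],
      kolyvagin N W K)
    (hPT : ∀ (K : Type) [Field K] [NumberField K], poitouTate_sum_localTatePairing_eq_zero K)
    (hEP : ∀ (K : Type) [Field K] [NumberField K] (v : HeightOneSpectrum (𝓞 K)),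
      localEulerPoincareCharacteristic (v.adicCompletion K))
    (hB : thm210_thm211_bdpDisplay_pNew) (hD : P2.IMCDivSomeFrameOnTree W p) :
    P2OpenInputOnTreeAt W p :=
  P2.openInputOnTreeAt_of_imcDivIntFrame hnf hGZK hKo hPT hEP
    (imcDivIntFrameOnTree_of_imcDivSomeFrame_of_pNew hB hD)

end Pair

/-! ### §3 The class record with the value half gone -/

/-- **ROUTE p2 — CLASS RECORD OVER (2.4)∃♭ ALONE (value half from print on EVERY pair).** `∀ (E,p) ∈`
X11b, `p ≥ 5 → BSD(E,p)` from route p2's and the lever's PUBLISHED named facts, the cited Poitou–Tate ∕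
local Euler characteristic, the REVIEWED fact `thm210_thm211_bdpDisplay_pNew` (Castella JIMJ 17 (2018)
Thms. 2.10–2.11: the value at `𝟙`, any conductor), and the typed inputs: **(2.4)∃♭
`P2.IMCDivSomeFrameOnTree` ON EVERY PAIR** (THE one open statement; conjecture-tagged; no value clause);
(REG) per pair; (TC) on split-only pairs with `p ∤ ∏c`; the exceptional conjecture on split-only pairs
with `p ∣ ∏c`; the corner. Compared with gen 25's `P2.bsdp_of_onTree_split`: the binder `hVal` (value∃♭
on the NON-semistable pairs) and `h32` (Cas18 Thms. 3.1–3.2 on the semistable ones) are GONE — H∃♭ is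
`imcDivIntFrameOnTree_of_imcDivSomeFrame_of_pNew` on every pair, fed to gen 24's
`P2.bsdp_of_onTree_intFrame`. CONDITIONAL on (2.4)∃♭ and the per-pair inputs; nothing booked; labels
UNCHANGED; X11b stays CONSTRUCTION-SHAPED. [cite: Castella2018Exceptional, Thms. 2.10–2.11 (arXiv:1507.04260 pp. 13–14)]
[cite: Castella2018Erratum, (2.4) (p. 4)] [cite: Castella2018, Thms. 2.3, 3.1, 3.2]
[cite: McCallumLMS1991, §1 Theorem (Kolyvagin), p. 296] [cite: Disegni2020, Thm. 1 (§1.2), Thm. 4, (∗)]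
[cite: Wuthrich2014, Thm. 3 (p. 383), Prop. 21 (p. 400)] [cite: SteinWuthrich2013, Thm. 6.1, §4.2]
[cite: Miller2011LMS, Def. 1.1] -/
theorem bsdp_of_onTree_split_of_pNew
    -- route p2's published inputs
    (hGZ : ∀ (N : ℕ) [NeZero N] (W : WeierstrassCurve ℚ) (K : Type) [Field K] [NumberField K],
      gross_zagier N W K)
    (hKo : ∀ (N : ℕ) [NeZero N] (W : WeierstrassCurve ℚ) (K : Type) [Field K] [NumberField K],
      kolyvagin N W K)
    (hBK : ∀ (N : ℕ) [NeZero N] (W : WeierstrassCurve ℚ) (K : Type) [Field K] [NumberField K],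
      Kolyvagin1990_padicValNat_card_sha_le N W K)
    (hWu : sha_dvd_analyticSha) (hGZK : rank_eq_analyticRank_of_analyticRank_le_one)
    (hnf : exists_isNewformOf) (hHL : HoffsteinLuo1997_exists_twist_L_one_ne_zero)
    (hMaz : mazur_not_dvd_maninConstant_of_odd) (hBDMTV : thm12_not_le_normalizer_splitCartan)
    (hPT : ∀ (K : Type) [Field K] [NumberField K], poitouTate_sum_localTatePairing_eq_zero K)
    (hEP : ∀ (K : Type) [Field K] [NumberField K] (v : HeightOneSpectrum (𝓞 K)),
      localEulerPoincareCharacteristic (v.adicCompletion K))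
    -- the lever's published inputs
    (hK : kato_charIdeal_dvd_multiplicative_of_surjective)
    (hJn : thm61_nonsplitMultiplicative) (hJs : thm61_splitMultiplicative)
    (hHn : exists_isMultCanonical) (hHs : exists_isSplitMultCanonical)
    (hD : thm1_padicBSD_rankOne_multiplicative) (hpar : nonempty_modularParametrizationData)
    -- Castella JIMJ 17 (2018) Thms. 2.10–2.11 (REVIEWED Literature fact; any conductor)
    (hB : thm210_thm211_bdpDisplay_pNew)
    -- THE ONE OPEN INPUT: (2.4)∃♭, every pair
    (hDiv : ∀ (W : WeierstrassCurve ℚ) [W.IsElliptic] [W.IsGloballyMinimal] (p : ℕ) [Fact p.Prime],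
      ClassX11b W p → 5 ≤ p → P2.IMCDivSomeFrameOnTree W p)
    -- (REG)
    (hReg : ∀ (W : WeierstrassCurve ℚ) [W.IsElliptic] [W.IsGloballyMinimal] (p : ℕ) [Fact p.Prime],
      ClassX11b W p → 5 ≤ p → ClassClosure.RegulatorNonvanishingAt W p)
    -- (TC) ONE twist certificate per split-only pair with `p ∤ ∏c`
    (hTC : ∀ (W : WeierstrassCurve ℚ) [W.IsElliptic] [W.IsGloballyMinimal] (p : ℕ) [Fact p.Prime],
      ClassX11b W p → 5 ≤ p → W.HasSplitMultiplicativeReductionAtPrime p →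
      (¬ ∃ (m : ℕ) (_ : Fact m.Prime), m ≠ p ∧ W.HasMultiplicativeReductionAtPrime m) →
      ¬ p ∣ W.tamagawaProduct →
      ∃ (K : Type) (_ : Field K) (_ : NumberField K) (Wd : WeierstrassCurve ℚ) (_ : Wd.IsElliptic)
        (_ : Wd.IsGloballyMinimal) (Cd : VariableChange ℚ) (qd : ℚ),
        IsImaginaryQuadratic K ∧ SatisfiesHeegnerHypothesis (W.conductorNorm ℤ) K ∧
        NumberField.discr K < -4 ∧ Cd • W.quadraticTwist (NumberField.discr K : ℚ) = Wd ∧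
        Wd.entireLFunction 1 / (Wd.realPeriodRat : ℂ) = (qd : ℂ) ∧ qd ≠ 0 ∧ padicValRat p qd = 0)
    -- (T2∗′) the exceptional conjecture, only on split-only pairs with `p ∣ ∏c`
    (hC : ∀ (W : WeierstrassCurve ℚ) [W.IsElliptic] [W.IsGloballyMinimal] (p : ℕ) [Fact p.Prime],
      ClassX11b W p → 5 ≤ p → W.HasSplitMultiplicativeReductionAtPrime p →
      (¬ ∃ (m : ℕ) (_ : Fact m.Prime), m ≠ p ∧ W.HasMultiplicativeReductionAtPrime m) →
      p ∣ W.tamagawaProduct → ClassClosure.RelativeExceptionalLeadingTermAt W p)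
    -- (T4′)
    (hCorner : ∀ (W : WeierstrassCurve ℚ) [W.IsElliptic] [W.IsGloballyMinimal] (p : ℕ)
      [Fact p.Prime], ClassX11b W p → ¬ Surj W p → (p = 5 ∨ p = 7) →
        p ∣ padicValInt p W.minimalDiscriminantInt → ¬ Ram W p → Typed.MissingPPartAt W p)
    (W : WeierstrassCurve ℚ) [W.IsElliptic] [W.IsGloballyMinimal] (p : ℕ) [Fact p.Prime]
    (hX : ClassX11b W p) (hp5 : 5 ≤ p) : BSDp W p :=
  P2.bsdp_of_onTree_intFrame hGZ hKo hBK hWu hGZK hnf hHL hMaz hBDMTV hPT hEP hK hJn hJs hHn hHs hD hpar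
    (fun W _ _ p _ hX hp5 ↦ imcDivIntFrameOnTree_of_imcDivSomeFrame_of_pNew hB (hDiv W p hX hp5))
    hReg hTC hC hCorner W p hX hp5

/-! ### §4 K2's two no-road residuals, re-read value-free -/

/-- **Item 19282 `OpenInputNotRam` (its body VERBATIM) ⟸ (2.4)∃♭ on the ¬(ram) pairs + print.** On
the pairs with no `E[p]`-ramified multiplicative prime (`¬ Ram W p`; cw 112 239 of 2 267 348) route p2's
composite open input follows from the VALUE-FREE shape `P2.IMCDivSomeFrameOnTree W p` there and the
published ∕ cited facts (`openInputOnTreeAt_of_imcDivSomeFrame_of_pNew`): after the planner's D4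
re-glue the ¬(ram) residual of route `ErratumRoadFive` may be read as «one inclusion of the
anticyclotomic IMC for SOME BDP frame at a classical Heegner field» on these rows — its value clause is
print. CONDITIONAL; nothing booked; NO road to (2.4)∃♭ at these data is claimed (none in print: BCS25
Thm. 1.2.4 is good ordinary; FW21 Thm. 4.41 ∕ Castella 2024 Thm. 3.1 (iii) need a non-split `q ∥ N`).
[cite: Castella2018Exceptional, Thms. 2.10–2.11 (arXiv:1507.04260 pp. 13–14)]
[cite: Castella2018Erratum, (2.4) (p. 4)] [cite: Castella2018, Thms. 2.3, 3.1, 3.2, §5]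
[cite: MilneADT2006, Ch. I, Thm. 4.10(b) and Thm. 2.8] -/
theorem openInputNotRam_of_imcDivSomeFrame_of_pNew (hnf : exists_isNewformOf)
    (hGZK : rank_eq_analyticRank_of_analyticRank_le_one)
    (hKo : ∀ (N : ℕ) [NeZero N] (W : WeierstrassCurve ℚ) (K : Type) [Field K] [NumberField K],
      kolyvagin N W K)
    (hPT : ∀ (K : Type) [Field K] [NumberField K], poitouTate_sum_localTatePairing_eq_zero K)
    (hEP : ∀ (K : Type) [Field K] [NumberField K] (v : HeightOneSpectrum (𝓞 K)),
      localEulerPoincareCharacteristic (v.adicCompletion K))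
    (hB : thm210_thm211_bdpDisplay_pNew)
    (hDiv : ∀ (W : WeierstrassCurve ℚ) [W.IsElliptic] [W.IsGloballyMinimal] (p : ℕ) [Fact p.Prime],
      ¬ Ram W p → P2.IMCDivSomeFrameOnTree W p) :
    ∀ (W : WeierstrassCurve ℚ) [W.IsElliptic] [W.IsGloballyMinimal] (p : ℕ) [Fact p.Prime],
      ¬ Ram W p → P2OpenInputOnTreeAt W p :=
  fun W _ _ p _ hnr ↦
    openInputOnTreeAt_of_imcDivSomeFrame_of_pNew hnf hGZK hKo hPT hEP hB (hDiv W p hnr)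

/-- **REST‴ — the planner's D4 crux `RamNoErratumDataAtFive` (text VERBATIM, imc-p1's `hrest` binder,
ℕ-divisibility spelling of `Ram`) ⟸ (2.4)∃♭ on its pairs + print.** On the (ram) pairs WITHOUT erratum
data (no odd non-split `E[p]`-ramified multiplicative `q ≠ p`, or `E(ℚ_p)[p] ≠ 0`; cw 703 204) route
p2's composite open input follows from the VALUE-FREE shape there and print. So BOTH no-road residuals
of route `ErratumRoadFive` after D4 are value-free: the BDP formula at `𝟙` is print on ALL classical
data at `p ≥ 5`. CONDITIONAL; nothing booked; no road to (2.4)∃♭ at these data is claimed.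
[cite: Castella2018Exceptional, Thms. 2.10–2.11 (arXiv:1507.04260 pp. 13–14)]
[cite: Castella2018Erratum, (2.4) and Thm. 1.1 (iii)–(iv) (pp. 1, 4)]
[cite: Castella2018, Thms. 2.3, 3.1, 3.2, §5] [cite: MilneADT2006, Ch. I, Thm. 4.10(b) and Thm. 2.8] -/
theorem ramNoErratumData_of_imcDivSomeFrame_of_pNew (hnf : exists_isNewformOf)
    (hGZK : rank_eq_analyticRank_of_analyticRank_le_one)
    (hKo : ∀ (N : ℕ) [NeZero N] (W : WeierstrassCurve ℚ) (K : Type) [Field K] [NumberField K],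
      kolyvagin N W K)
    (hPT : ∀ (K : Type) [Field K] [NumberField K], poitouTate_sum_localTatePairing_eq_zero K)
    (hEP : ∀ (K : Type) [Field K] [NumberField K] (v : HeightOneSpectrum (𝓞 K)),
      localEulerPoincareCharacteristic (v.adicCompletion K))
    (hB : thm210_thm211_bdpDisplay_pNew)
    (hDiv : ∀ (W : WeierstrassCurve ℚ) [W.IsElliptic] [W.IsGloballyMinimal] (p : ℕ) [Fact p.Prime],
      Ram W p →
      ¬ ((∃ (q : ℕ) (_ : Fact q.Prime), q ≠ 2 ∧ q ≠ p ∧ Mult W q ∧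
          ¬ W.HasSplitMultiplicativeReductionAtPrime q ∧ ¬ p ∣ padicValInt q W.minimalDiscriminantInt) ∧
        (∀ P : (W.baseChange ℚ_[p]).toAffine.Point, p • P = 0 → P = 0)) →
      P2.IMCDivSomeFrameOnTree W p) :
    ∀ (W : WeierstrassCurve ℚ) [W.IsElliptic] [W.IsGloballyMinimal] (p : ℕ) [Fact p.Prime],
      Ram W p →
      ¬ ((∃ (q : ℕ) (_ : Fact q.Prime), q ≠ 2 ∧ q ≠ p ∧ Mult W q ∧
          ¬ W.HasSplitMultiplicativeReductionAtPrime q ∧ ¬ p ∣ padicValInt q W.minimalDiscriminantInt) ∧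
        (∀ P : (W.baseChange ℚ_[p]).toAffine.Point, p • P = 0 → P = 0)) →
      P2OpenInputOnTreeAt W p :=
  fun W _ _ p _ hr hno ↦
    openInputOnTreeAt_of_imcDivSomeFrame_of_pNew hnf hGZK hKo hPT hEP hB (hDiv W p hr hno)

end Summit.BirchSwinnertonDyer.BirchSwinnertonDyer.Theorems

end
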